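import Summits.QuantumFields.YangMills.Theorems.AlphaInputsT3ACMinimiserPinTriv
import Literature.MathematicalPhysics.QuantumFieldTheory.Balaban1983to89.T3SmallLiftHistory
import HarnessLib

/-!
# `AlphaInputsT3ACMinimiserPinConsts` — THE CONSTANTS SIDE CONDITIONS OF THE TRIVIAL-HISTORY PIN ARE MET FOR SMALL COUPLING: the two `γ`-dependent
# provisos of `AlphaInputsT3AC.trivMinimiserRowsT3_of_thm1GlobalMinAt` (windows inside the shell; (N1)-type `C68`-domination) hold for EVERY run `K`
# as soon as `γ ≤ γ₁(L, b₀, p₀, a₁)` and `C68 ≥ 4B₃·L²·avgWindowFactor(L)` — lane `pub-balaban3d`, seat alpha-1 (g6)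

Cell `ym3-torus`, route `UnitScaleTilt`, crux 2′ `stub_laneRecordsV3` (stmt-QuantumFields-19936 ∕ -19935), strategy B, row (D5) at the trivial history.
After `…MinimiserPinTriv`, lane B's displayed `TrivMinimiserRowsT3` follows from `Thm1GlobalMinAt F.L a₀ a₁ 𝔠.B₃` and constants side conditions; the two that
mention `γ` and `K` are discharged here by the tree's threshold analysis (`θBal = g·p(g)`, `g_i = √(γL^{−i})`):
* §1 `θ(j) ≤ L·θ(j+1)` (`T3SmallLiftHistory.sqrt_inv_mul_θBal_le_succ`, `√L ≤ L`) and its iterate `θ(j) ≤ L^d·θ(j+d)`;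
* §2 WINDOWS INSIDE THE SHELL: `T3ThresholdSmallness.exists_forall_θBal_le` (uniform in the height) gives `γ₁` with `2L²·B·θBal(K−k+1) ≤ a₁` for all `K, k`;
* §3 THE `C68`-DOMINATION: for `√γ ≤ e^{1−p₀}` (`T3Thresholds.θBal_le_of_le`: `θ` antitone) and `4B₃L²B ≤ C68`:
  `2B₃·(2L²Bθ(K−k+1))·L^{−2(k−i)} ≤ C68·θ(K−i)` for all `i ≤ k ≤ K` (`i = k`: antitone; `i < k`: §1 with `d = k − i − 1`, `L^{d−2(d+1)} ≤ 1`);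
* §4 ★ `exists_gamma_trivMinimiserRowsT3`: for `𝔠` with `1 ≤ 2B₃`, `4B₃L²·avgWindowFactor(L) ≤ C68`, and [7] constants `(a₀, a₁)` with `Thm1GlobalMinAt F.L a₀ a₁ 𝔠.B₃`
  (DISPLAYED), `B₃a₁ ≤ a₀`, `2B₃a₁` Prop.-2-admissible: `∃ γ₁ > 0` such that for every coupling `γ ≤ γ₁` of the record's window and every `K` there is `Ut`
  with `AlphaInputsT3AC.TrivMinimiserRowsT3 F 𝔠 γ hγ hγ1 a₀ a₁ K Ut`;
* §5 lane B's displayed (N1) `AlphaInputsT3AC.WindowIneqT3 F 𝔠 γ K` in the same regime from `2L²·avgWindowFactor(L) ≤ C68`;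
* §6 `thm1GlobalMinAt_mono`: the displayed [7] schema is monotone in `(a₁, B₃)`, so `1 ≤ 2B₃` and a small `a₁` cost the record nothing;
* §7 the record's window closes with `C68`: `γ ≤ (min γ₀ 1)² ≤ γ₀ ≤ γ₇₁ ≤ (3C₀(3)·C68·b₀Q₀(p₀))⁻²` (`window_le_of_C68`), so §4's `γ₁` is met by `C68` large at
  fixed profile `(b₀, p₀)`.
HONEST FRAMING.  Kernel theorems about the tree's own objects; `Thm1GlobalMinAt` stays DISPLAYED.  The record's own window `γ ≤ (min γ₀ 1)²` lies below
`γ₁` once `C68 ≥ (3C₀(3)·b₀Q₀(p₀)·√γ₁)⁻¹` (§7) — a size condition on the exhibited `𝔠` at fixed profile, nothing claimed about a specific record.  No `def`, no `instance`, no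
`sorry`; count-neutral; not a claim about the continuum limit or the mass gap.
References: T. Bałaban, Commun. Math. Phys. 102 (1985) 255–275 [Balaban1985UV3], (3) p. 256, (7) p. 257, (40) p. 266, (68) p. 273; Commun. Math. Phys. 102
(1985) 277–309 [Balaban1985Variational], Thm 1 pp. 278–279.
-/

set_option autoImplicit false

noncomputable section

namespace Summit.QuantumFields.YangMills.Theorems.MinimiserPin

open MeasureTheory
open Literature.MathematicalPhysics.QuantumFieldTheory.Balaban1983to89
open Literature.MathematicalPhysics.QuantumFieldTheory.Balaban1983to89.T3ContinuumYM3Torus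
open Literature.MathematicalPhysics.QuantumFieldTheory.Balaban1983to89.T3UnitScaleTilt (θBal)
open Literature.MathematicalPhysics.QuantumFieldTheory.Balaban1983to89.T3MinimiserStabilityReduction (θBal_pos)
open Literature.MathematicalPhysics.QuantumFieldTheory.Balaban1983to89.T3PrintedMinimiserExistence (Thm1GlobalMinAt)
open Literature.MathematicalPhysics.QuantumFieldTheory.Balaban1983to89.T3ThresholdSmallness (exists_forall_θBal_le)
open Literature.MathematicalPhysics.QuantumFieldTheory.Balaban1983to89.T3Thresholds (θBal_le_of_le sqrt_le_exp_iff)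
open Literature.MathematicalPhysics.QuantumFieldTheory.Balaban1983to89.ExpMeanLog (deltaSU)
open Summit.QuantumFields.Balaban3D.Carriers
open Summit.QuantumFields.Balaban3D.Proofs.Primitives

/-! ## §1 One step down costs at most a factor `L` -/

section Ratio

variable {L : ℕ} {γ b₀ p₀ : ℝ}

/-- `θ(j) ≤ L·θ(j+1)` (`0 < γ ≤ 1`, `L ≥ 1`, `b₀, p₀ ≥ 0`): the gain `κ = L⁻¹` satisfies `κ√L ≤ 1` (`T3SmallLiftHistory.mul_θBal_le_θBal_succ`).
[cite: Balaban1985UV3, (3) p.256 and (7) p.257] -/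
theorem θBal_le_L_mul_succ (hL : 1 ≤ L) (hγ : 0 < γ) (hγ1 : γ ≤ 1) (hb : 0 ≤ b₀) (hp : 0 ≤ p₀) (j : ℕ) :
    θBal L γ b₀ p₀ j ≤ (L : ℝ) * θBal L γ b₀ p₀ (j + 1) := by
  have hL1 : (1 : ℝ) ≤ (L : ℝ) := by exact_mod_cast hL
  have hLpos : (0 : ℝ) < (L : ℝ) := by linarith
  have hsqrt : Real.sqrt (L : ℝ) ≤ (L : ℝ) := by
    calc Real.sqrt (L : ℝ) ≤ Real.sqrt ((L : ℝ) ^ 2) := Real.sqrt_le_sqrt (by nlinarith)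
      _ = (L : ℝ) := Real.sqrt_sq hLpos.le
  have hκ : (L : ℝ)⁻¹ * Real.sqrt (L : ℝ) ≤ 1 := by
    rw [inv_mul_le_iff₀ hLpos, mul_one]
    exact hsqrt
  have h := T3SmallLiftHistory.mul_θBal_le_θBal_succ hL hγ hγ1 hb hp hκ j
  rwa [inv_mul_le_iff₀ hLpos] at h

/-- `θ(j) ≤ L^d·θ(j+d)`: `d` steps down cost at most `L^d`. [cite: Balaban1985UV3, (3) p.256 and (7) p.257] -/
theorem θBal_le_pow_mul_add (hL : 1 ≤ L) (hγ : 0 < γ) (hγ1 : γ ≤ 1) (hb : 0 ≤ b₀) (hp : 0 ≤ p₀) (j : ℕ) :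
    ∀ d : ℕ, θBal L γ b₀ p₀ j ≤ (L : ℝ) ^ d * θBal L γ b₀ p₀ (j + d)
  | 0 => by simp
  | d + 1 => by
    have hLd : (0 : ℝ) ≤ (L : ℝ) ^ d := by positivity
    calc θBal L γ b₀ p₀ j ≤ (L : ℝ) ^ d * θBal L γ b₀ p₀ (j + d) := θBal_le_pow_mul_add hL hγ hγ1 hb hp j d
      _ ≤ (L : ℝ) ^ d * ((L : ℝ) * θBal L γ b₀ p₀ (j + d + 1)) :=
          mul_le_mul_of_nonneg_left (θBal_le_L_mul_succ hL hγ hγ1 hb hp (j + d)) hLd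
      _ = (L : ℝ) ^ (d + 1) * θBal L γ b₀ p₀ (j + (d + 1)) := by rw [pow_succ]; ring_nf

end Ratio

/-! ## §2 The (40) windows lie inside the shell for small coupling -/

section Window

/-- **WINDOWS INSIDE THE SHELL**: for every `a₁ > 0` there is `γ₁ > 0` with `2L²·B·θBal L γ b₀ p₀ (K − k + 1) ≤ a₁` for all `0 < γ ≤ γ₁` and all `K, k`
(`T3ThresholdSmallness.exists_forall_θBal_le`, uniform in the height). [cite: Balaban1985UV3, (7) p.257 and (40) p.266; Balaban1985Variational, Thm 1 p.279] -/
theorem exists_gamma_window {L : ℕ} (hL : 1 ≤ L) (b₀ p₀ : ℝ) {B a₁ : ℝ} (hB : 0 < B) (ha₁ : 0 < a₁) :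
    ∃ γ₁ : ℝ, 0 < γ₁ ∧ ∀ γ : ℝ, 0 < γ → γ ≤ γ₁ → ∀ K k : ℕ, 2 * (L : ℝ) ^ 2 * B * θBal L γ b₀ p₀ (K - k + 1) ≤ a₁ := by
  have hL2B : 0 < 2 * (L : ℝ) ^ 2 * B := by
    have : (0 : ℝ) < (L : ℝ) := by exact_mod_cast (by omega : 0 < L)
    positivity
  obtain ⟨γ₁, hγ₁, hθ⟩ := exists_forall_θBal_le hL b₀ p₀ (div_pos ha₁ hL2B)
  refine ⟨γ₁, hγ₁, fun γ hγ hγle K k => ?_⟩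
  have h := mul_le_mul_of_nonneg_left (hθ γ hγ hγle (K - k + 1)) hL2B.le
  rwa [mul_div_cancel₀ _ hL2B.ne'] at h

end Window

/-! ## §3 The (N1)-type `C68`-domination for `C68 ≥ 4B₃L²B` in the antitone regime of the thresholds -/

section Domination

variable {L : ℕ} {γ b₀ p₀ : ℝ}

/-- `θ(K−k+1)·L^{−2(k−i)} ≤ θ(K−i)` for `i ≤ k ≤ K` (`√γ ≤ e^{1−p₀}`): at `i = k` the thresholds are antitone (`T3Thresholds.θBal_le_of_le`); at `i < k`
the `d − 1 = k − i − 1` steps down from `K − k + 1` to `K − i` cost `L^{d−1}` (§1), paid by `L^{−2d}`. [cite: Balaban1985UV3, (7) p.257 and (68) p.273] -/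
theorem θBal_window_le_level (hL : 1 ≤ L) (hγ : 0 < γ) (hγ1 : γ ≤ 1) (hγe : Real.sqrt γ ≤ Real.exp (1 - p₀)) (hb : 0 < b₀) (hp : 0 ≤ p₀)
    {K k i : ℕ} (hik : i ≤ k) (hkK : k ≤ K) :
    θBal L γ b₀ p₀ (K - k + 1) * (((L : ℝ) ^ (k - i))⁻¹) ^ 2 ≤ θBal L γ b₀ p₀ (K - i) := by
  have hL1 : (1 : ℝ) ≤ (L : ℝ) := by exact_mod_cast hL
  rcases Nat.eq_or_lt_of_le hik with rfl | hlt
  · -- `i = k`: antitone thresholds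
    simp only [Nat.sub_self, pow_zero, inv_one, one_pow, mul_one]
    exact θBal_le_of_le hL hγ hγ1 hγe hb.le hp (by omega)
  · -- `i < k`: `d = k − i ≥ 1`, `K − i = (K − k + 1) + (d − 1)`
    have hθ := θBal_le_pow_mul_add hL hγ hγ1 hb.le hp (K - k + 1) (k - i - 1)
    have heq : K - k + 1 + (k - i - 1) = K - i := by omega
    rw [heq] at hθ
    have hθi : 0 ≤ θBal L γ b₀ p₀ (K - i) := (θBal_pos hL hγ hγ1 hb p₀ (K - i)).le
    have hpow : (L : ℝ) ^ (k - i - 1) * (((L : ℝ) ^ (k - i))⁻¹) ^ 2 ≤ 1 := by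
      rw [← inv_pow, ← pow_mul, mul_comm (k - i) 2]
      have hLki : (0 : ℝ) < (L : ℝ) ^ (2 * (k - i)) := by positivity
      rw [inv_pow, mul_inv_le_iff₀ hLki, one_mul]
      exact pow_le_pow_right₀ hL1 (by omega)
    have hinv : 0 ≤ (((L : ℝ) ^ (k - i))⁻¹) ^ 2 := by positivity
    calc θBal L γ b₀ p₀ (K - k + 1) * (((L : ℝ) ^ (k - i))⁻¹) ^ 2
        ≤ ((L : ℝ) ^ (k - i - 1) * θBal L γ b₀ p₀ (K - i)) * (((L : ℝ) ^ (k - i))⁻¹) ^ 2 := mul_le_mul_of_nonneg_right hθ hinv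
      _ = ((L : ℝ) ^ (k - i - 1) * (((L : ℝ) ^ (k - i))⁻¹) ^ 2) * θBal L γ b₀ p₀ (K - i) := by ring
      _ ≤ 1 * θBal L γ b₀ p₀ (K - i) := mul_le_mul_of_nonneg_right hpow hθi
      _ = θBal L γ b₀ p₀ (K - i) := one_mul _

/-- **THE `C68`-DOMINATION OF `row3_triv_of_levelBound` HOLDS FOR `C68 ≥ 4B₃L²B`** in the antitone regime `√γ ≤ e^{1−p₀}` (`0 < γ ≤ 1`):
`2B₃·(2L²Bθ(K−k+1))·L^{−2(k−i)} ≤ C68·θ(K−i)` for all `i ≤ k ≤ K`. [cite: Balaban1985UV3, (40) p.266 and (68) p.273] -/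
theorem C68_dom_of_le (hL : 1 ≤ L) (hγ : 0 < γ) (hγ1 : γ ≤ 1) (hγe : Real.sqrt γ ≤ Real.exp (1 - p₀)) (hb : 0 < b₀) (hp : 0 ≤ p₀)
    {B B₃ C68 : ℝ} (hB : 0 ≤ B) (hB₃ : 0 ≤ B₃) (hC : 4 * B₃ * (L : ℝ) ^ 2 * B ≤ C68) (K k i : ℕ) (hik : i ≤ k) (hkK : k ≤ K) :
    2 * B₃ * (2 * (L : ℝ) ^ 2 * B * θBal L γ b₀ p₀ (K - k + 1)) * (((L : ℝ) ^ (k - i))⁻¹) ^ 2 ≤ C68 * θBal L γ b₀ p₀ (K - i) := by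
  have hθi : 0 ≤ θBal L γ b₀ p₀ (K - i) := (θBal_pos hL hγ hγ1 hb p₀ (K - i)).le
  have hkey := θBal_window_le_level hL hγ hγ1 hγe hb hp hik hkK
  have h4 : 0 ≤ 4 * B₃ * (L : ℝ) ^ 2 * B := by positivity
  calc 2 * B₃ * (2 * (L : ℝ) ^ 2 * B * θBal L γ b₀ p₀ (K - k + 1)) * (((L : ℝ) ^ (k - i))⁻¹) ^ 2
      = (4 * B₃ * (L : ℝ) ^ 2 * B) * (θBal L γ b₀ p₀ (K - k + 1) * (((L : ℝ) ^ (k - i))⁻¹) ^ 2) := by ring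
    _ ≤ (4 * B₃ * (L : ℝ) ^ 2 * B) * θBal L γ b₀ p₀ (K - i) := mul_le_mul_of_nonneg_left hkey h4
    _ ≤ C68 * θBal L γ b₀ p₀ (K - i) := mul_le_mul_of_nonneg_right hC hθi

end Domination

/-! ## §4 ★ (D5) for every run at small coupling -/

section Small

/-- ★ **(D5) AT SMALL COUPLING, FROM [7] THEOREM 1 AND TWO SIZE CONDITIONS ON `𝔠`.**  For lane constants with `1 ≤ 2B₃` and `4B₃L²·avgWindowFactor(L) ≤ C68`, and
[7] constants `(a₀, a₁)` with `Thm1GlobalMinAt F.L a₀ a₁ 𝔠.B₃` (DISPLAYED), `0 < a₁`, `B₃a₁ ≤ a₀`, `2B₃a₁` admissible for [Balaban1985Averaging] Prop. 2: there is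
`γ₁ > 0` such that for every coupling `γ ≤ γ₁` of the record's window and EVERY run `K`, lane B's displayed row `AlphaInputsT3AC.TrivMinimiserRowsT3 F 𝔠 γ hγ hγ1 a₀ a₁ K Ut`
holds for some measurable trivial-history family `Ut`. [cite: Balaban1985Variational, Thm 1 (6)–(8) pp.278–279; Balaban1985UV3, (40)–(42) p.266 and (68) p.273] -/
theorem exists_gamma_trivMinimiserRowsT3 (F : T3Family) (𝔠 : AlphaConsts F.L (suGroupModel 2).N) {a₀ a₁ : ℝ}
    (hT : Thm1GlobalMinAt F.L a₀ a₁ 𝔠.B₃) (ha₁ : 0 < a₁) (hwin : 𝔠.B₃ * a₁ ≤ a₀)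
    (hA3 : (143 * ((((3 + 4 : ℕ) : ℝ)) ^ 2 / 4) ^ 2) * (2 * (𝔠.B₃ * a₁)) ≤ 1 / 3)
    (hA2 : 2 * (2 * (𝔠.B₃ * a₁)) ≤ 2 * deltaSU (Fin 2) / (((3 + 4) * F.L : ℕ) : ℝ) ^ 2)
    (hB₃ : 1 ≤ 2 * 𝔠.B₃) (hC : 4 * 𝔠.B₃ * (F.L : ℝ) ^ 2 * avgWindowFactor F.L ≤ 𝔠.C68) :
    ∃ γ₁ : ℝ, 0 < γ₁ ∧ ∀ (γ : ℝ) (hγ : 0 < γ) (hγ1 : γ ≤ (min 𝔠.gamma0 1) ^ 2), γ ≤ γ₁ → ∀ K : ℕ,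
      ∃ Ut : (k : ℕ) → GaugeField (F.P K) k (Matrix.specialUnitaryGroup (Fin 2) ℂ) → GaugeField (F.P K) 0 (Matrix.specialUnitaryGroup (Fin 2) ℂ),
        AlphaInputsT3AC.TrivMinimiserRowsT3 F 𝔠 γ hγ hγ1 a₀ a₁ K Ut := by
  have hL1 : 1 ≤ F.L := by have := F.hL.2; omega
  obtain ⟨γw, hγw, hwin'⟩ := exists_gamma_window hL1 𝔠.b₀ 𝔠.p₀ (avgWindowFactor_pos F) ha₁
  refine ⟨min γw (Real.exp (2 * (1 - 𝔠.p₀))), lt_min hγw (Real.exp_pos _), fun γ hγ hγ1 hγle K => ?_⟩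
  have hγ1' : γ ≤ 1 := hγ1.trans (sq_min_one_le _ 𝔠.gamma0_pos)
  have hγe : Real.sqrt γ ≤ Real.exp (1 - 𝔠.p₀) := (sqrt_le_exp_iff hγ.le).mpr (hγle.trans (min_le_right _ _))
  exact AlphaInputsT3AC.trivMinimiserRowsT3_of_thm1GlobalMinAt F 𝔠 γ hγ hγ1 K hT hwin hA3 hA2 hB₃
    (fun k _ => hwin' γ hγ (hγle.trans (min_le_left _ _)) K k)
    (fun k i hik hkK => C68_dom_of_le hL1 hγ hγ1' hγe 𝔠.b₀_pos 𝔠.p₀_pos.le (avgWindowFactor_pos F).le 𝔠.B₃_pos.le hC K k i hik hkK)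

end Small

/-! ## §5 Lane B's displayed (N1) `WindowIneqT3` at small coupling -/

section WindowIneq

/-- **(N1) FROM THE SAME SIZE CONDITION**: in the antitone regime `√γ ≤ e^{1−p₀}` (`0 < γ ≤ 1`), `2L²·avgWindowFactor(L) ≤ C68` gives lane B's displayed
window inequality `AlphaInputsT3AC.WindowIneqT3 F 𝔠 γ K` (`2L²·avgWindowFactor(L)·θBal(K+1) ≤ C68·θBal(K)`) for every run `K`. [cite: Balaban1985UV3, (40) p.266 and (68) p.273] -/
theorem windowIneqT3_of_le (F : T3Family) (𝔠 : AlphaConsts F.L (suGroupModel 2).N) {γ : ℝ} (hγ : 0 < γ) (hγ1 : γ ≤ 1)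
    (hγe : Real.sqrt γ ≤ Real.exp (1 - 𝔠.p₀)) (hC : 2 * (F.L : ℝ) ^ 2 * avgWindowFactor F.L ≤ 𝔠.C68) (K : ℕ) :
    AlphaInputsT3AC.WindowIneqT3 F 𝔠 γ K := by
  have hL1 : 1 ≤ F.L := by have := F.hL.2; omega
  have hθ : θBal F.L γ 𝔠.b₀ 𝔠.p₀ (K + 1) ≤ θBal F.L γ 𝔠.b₀ 𝔠.p₀ K :=
    θBal_le_of_le hL1 hγ hγ1 hγe 𝔠.b₀_pos.le 𝔠.p₀_pos.le (Nat.le_succ K)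
  have hθ0 : 0 ≤ θBal F.L γ 𝔠.b₀ 𝔠.p₀ K := (θBal_pos hL1 hγ hγ1 𝔠.b₀_pos 𝔠.p₀ K).le
  have hw0 : 0 ≤ 2 * (F.L : ℝ) ^ 2 * avgWindowFactor F.L := by
    have := avgWindowFactor_pos F
    positivity
  unfold AlphaInputsT3AC.WindowIneqT3
  calc 2 * (F.L : ℝ) ^ 2 * avgWindowFactor F.L * θBal F.L γ 𝔠.b₀ 𝔠.p₀ (K + 1)
      ≤ 2 * (F.L : ℝ) ^ 2 * avgWindowFactor F.L * θBal F.L γ 𝔠.b₀ 𝔠.p₀ K := mul_le_mul_of_nonneg_left hθ hw0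
    _ ≤ 𝔠.C68 * θBal F.L γ 𝔠.b₀ 𝔠.p₀ K := mul_le_mul_of_nonneg_right hC hθ0

end WindowIneq

/-! ## §6 The displayed [7] schema is monotone in `(a₁, B₃)` — the size condition `1 ≤ 2B₃` costs nothing -/

section Mono

open Literature.MathematicalPhysics.QuantumFieldTheory.Balaban1983to89.T3PrintedMinimiserExistence (regFibrePr_mono)

/-- **`Thm1GlobalMinAt` IS MONOTONE**: shrinking `a₁` and enlarging `B₃` (keeping `a₀`) weakens the schema — fewer admissible pairs, a larger space (8).  So a
record may take `B₃ ≥ ½` (and `a₁` small) without strengthening the displayed [7] hypothesis. [cite: Balaban1985Variational, Thm 1 (6)–(8) pp.278–279] -/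
theorem thm1GlobalMinAt_mono {L : ℕ} {a₀ a₁ a₁' B₃ B₃' : ℝ} (h : Thm1GlobalMinAt L a₀ a₁ B₃) (ha : a₁' ≤ a₁) (hB : B₃ ≤ B₃') :
    Thm1GlobalMinAt L a₀ a₁' B₃' := by
  intro F hF n K hnK ε₁ ε₀ h₁ h₂ h₃ h₄ V hV
  have hBε : B₃ * ε₁ ≤ B₃' * ε₁ := mul_le_mul_of_nonneg_right hB h₁.le
  obtain ⟨U, hU, hmin⟩ := h F hF n K hnK ε₁ ε₀ h₁ (h₂.trans ha) (hBε.trans h₃) h₄ V hV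
  exact ⟨U, regFibrePr_mono F hBε V hU, hmin⟩

end Mono

/-! ## §7 The record's coupling window shrinks with `C68`: `γ ≤ (min γ₀ 1)² ≤ γ₀ ≤ γ₇₁ ≤ (3C₀(3)·C68·b₀Q₀(p₀))⁻²` -/

section Gamma0

open Summit.QuantumFields.Balaban3D.Proofs.Thresholds (gammaOf sigma68 sigma68_pos Q0 Q0_pos)
open Summit.QuantumFields.Balaban3D.Proofs.Constants (gammaMin_le gammaMin_le_one)
open B7Prop2Explicit (C0 C0_pos)

variable {L N : ℕ} (𝔠 : AlphaConsts L N)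

/-- `γ₀ ≤ γ₇₁` (`γ₀` is the minimum of the four listed thresholds). [cite: Balaban1985UV3, p.256 L15–18 (bookkeeping)] -/
theorem gamma0_le_gamma71 : 𝔠.gamma0 ≤ 𝔠.gamma71 := by
  unfold AlphaConsts.gamma0
  exact gammaMin_le (by simp)

/-- **`γ₇₁ ≤ (3C₀(3)·C68·b₀·Q₀(p₀))⁻²`**: the (71) threshold `γ(sigma68 C68 L)` with `sigma68 ≤ 1/(3C₀(3)C68)` and `γ(σ) ≤ (σ/(b₀Q₀))²` — so the record's
coupling window closes as `C68` grows (the free constant that also meets §3's domination). [cite: Balaban1985UV3, (68)–(71) p.273 (bookkeeping)] -/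
theorem gamma71_le_inv_sq : 𝔠.gamma71 ≤ ((3 * C0 3 * 𝔠.C68 * (𝔠.b₀ * Q0 𝔠.p₀))⁻¹) ^ 2 := by
  have hL : 1 ≤ L := 𝔠.one_lt_L.le
  have hC0 := C0_pos 3
  have hC68 := 𝔠.C68_pos
  have hbQ : 0 < 𝔠.b₀ * Q0 𝔠.p₀ := mul_pos 𝔠.b₀_pos (Q0_pos 𝔠.p₀_pos)
  have hσ0 : 0 ≤ sigma68 𝔠.C68 L := (sigma68_pos hC68 hL).le
  have hσ : sigma68 𝔠.C68 L ≤ 1 / (3 * C0 3 * 𝔠.C68) := min_le_left _ _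
  show gammaOf 𝔠.b₀ 𝔠.p₀ (sigma68 𝔠.C68 L) ≤ _
  unfold gammaOf
  refine (min_le_right _ _).trans ?_
  have hq : sigma68 𝔠.C68 L / (𝔠.b₀ * Q0 𝔠.p₀) ≤ (3 * C0 3 * 𝔠.C68 * (𝔠.b₀ * Q0 𝔠.p₀))⁻¹ := by
    have heq : (3 * C0 3 * 𝔠.C68 * (𝔠.b₀ * Q0 𝔠.p₀))⁻¹ * (𝔠.b₀ * Q0 𝔠.p₀) = 1 / (3 * C0 3 * 𝔠.C68) := by
      rw [mul_inv, mul_assoc _ ((𝔠.b₀ * Q0 𝔠.p₀)⁻¹), inv_mul_cancel₀ hbQ.ne', mul_one, one_div]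
    rw [div_le_iff₀ hbQ, heq]
    exact hσ
  exact pow_le_pow_left₀ (div_nonneg hσ0 hbQ.le) hq 2

/-- `γ₀ ≤ (3C₀(3)·C68·b₀·Q₀(p₀))⁻²`. [cite: Balaban1985UV3, p.256 L15–18 and (68)–(71) p.273 (bookkeeping)] -/
theorem gamma0_le_inv_sq : 𝔠.gamma0 ≤ ((3 * C0 3 * 𝔠.C68 * (𝔠.b₀ * Q0 𝔠.p₀))⁻¹) ^ 2 :=
  (gamma0_le_gamma71 𝔠).trans (gamma71_le_inv_sq 𝔠)

/-- Every coupling of the record's window is below `γ₀`: `γ ≤ (min γ₀ 1)² ≤ min γ₀ 1 ≤ γ₀`. [cite: Balaban1985UV3, p.256 L15–18 (bookkeeping)] -/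
theorem le_gamma0_of_window {γ : ℝ} (hγ1 : γ ≤ (min 𝔠.gamma0 1) ^ 2) : γ ≤ 𝔠.gamma0 := by
  have h0 : 0 ≤ min 𝔠.gamma0 1 := le_min 𝔠.gamma0_pos.le zero_le_one
  have h1 : min 𝔠.gamma0 1 ≤ 1 := min_le_right _ _
  have hsq : (min 𝔠.gamma0 1) ^ 2 ≤ min 𝔠.gamma0 1 := by nlinarith
  exact hγ1.trans (hsq.trans (min_le_left _ _))

/-- **HENCE**: if `(3C₀(3)·C68·b₀Q₀(p₀))⁻² ≤ γ₁`, every coupling of the record's window satisfies `γ ≤ γ₁` — the form in which §4's `γ₁` is met by a record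
with `C68` large. [cite: Balaban1985UV3, p.256 L15–18 and (68)–(71) p.273 (bookkeeping)] -/
theorem window_le_of_C68 {γ γ₁ : ℝ} (hγ1 : γ ≤ (min 𝔠.gamma0 1) ^ 2) (hC : ((3 * C0 3 * 𝔠.C68 * (𝔠.b₀ * Q0 𝔠.p₀))⁻¹) ^ 2 ≤ γ₁) :
    γ ≤ γ₁ :=
  ((le_gamma0_of_window 𝔠 hγ1).trans (gamma0_le_inv_sq 𝔠)).trans hC

end Gamma0

end Summit.QuantumFields.YangMills.Theorems.MinimiserPin

end
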